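import Summits.QuantumFields.YangMills.Theorems.UnitScaleTiltHalvingP1FlatCoreFrameLinTower
import Literature.MathematicalPhysics.QuantumFieldTheory.Balaban1983to89.B7Eq170Flat
import Literature.MathematicalPhysics.QuantumFieldTheory.Balaban1983to89.B8Lemma1NonAbelian
import Literature.Analysis.Complex.RungeUnits
import Literature.Analysis.Calculus.ExpLocalLieSubalgebra
import HarnessLib

/-!
# Line H (`BirthV10.stub_halvingStep`), J4 induction: the `W`-factor `G = eml(s)·eml(hol·s)⁻¹·eml(hol)` is `1 + O(δ·m)`

Crux `stmt-QuantumFields-19200` (`MinimiserStabilityRegPr`), line `birth_v10`, pillar P1♭ clause (o).  In the exact step of the effective gauges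
(✓`P1FlatCoreFrameLinTower.effGauge_step_eq_eml_G`) every dependence on the field sits in ONE factor
`G = eml_i(s_i) · eml_i(hol_i · s_i)⁻¹ · eml_i(hol_i)` (`hol_i` the centre stairs of the current double-bar iterate, `s_i` the relative
gauge factors); `G = 1` if `hol ≡ 1` (torus-axial field) or `s ≡ 1` (no correction).  THIS FILE: the product-form estimate
`‖G − 1‖ ≤ 28·δ·m` for `‖hol_i − 1‖ ≤ δ`, `‖s_i − 1‖ ≤ m`, `δ + m ≤ 1/40` — so that the k-fold induction in log-RELATIVE currency keeps
k-UNIFORM constants for a general (charted, non-axial) field: per level the extra error is `C·δ_j·m`, with `δ_j` geometric down the tower.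

The proof: two uses of the PRODUCT-form BCH remainder bound `‖log(e^A e^B) − A − B‖ ≤ 2‖A‖‖B‖` ([Balaban1985Averaging] (31),
✓`B7Eq170Flat.norm_bchRem_le`) and two Lipschitz bounds of `exp` on balls; no mixed-derivative lemma.
-/

noncomputable section

namespace Summit.QuantumFields.YangMills.Theorems.P1FlatCoreFrameLinGFactor

open NormedSpace
open Literature.MathematicalPhysics.QuantumFieldTheory.Balaban1983to89
open ExpMeanLog MatrixLog
open T4Continuum BlockAveraging
open B10Eq27TorusAxialLog (holT gaugeActT)
open B7TransferAnalyticMean (meanCLM meanCLM_apply)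
open BlockAveragingEMLAnalyticMean (eml_eq_exp_meanCLM)
open B7Eq170Flat (bchRem bchRem_def norm_bchRem_le)
open B8Lemma1NonAbelian (norm_exp_le_of_norm_le)
open B12Membership313II (norm_expMul_sub_one_lt_one)
open Literature.Analysis.Complex (norm_exp_sub_exp_le)
open Summit.QuantumFields.YangMills.Theorems.P1FlatCoreFrameLinBCH (norm_meanCLM_le_of_forall_le)
open Summit.QuantumFields.YangMills.Theorems.Prop8ChartDoubleBar (vframeU coe_vframeU)

variable {𝔸 : Type*} [NormedRing 𝔸] [NormedAlgebra ℂ 𝔸] [NormOneClass 𝔸] [CompleteSpace 𝔸]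

/-! ## §1 The abstract three-exponential factor -/

/-- Lipschitz bound of `exp` on the ball of radius `3/20`: `‖e^x − e^y‖ ≤ (13/10)·‖x − y‖`. [folklore] -/
theorem norm_exp_sub_exp_le_small {x y : 𝔸} (hx : ‖x‖ ≤ 3 / 20) (hy : ‖y‖ ≤ 3 / 20) :
    ‖exp x - exp y‖ ≤ 13 / 10 * ‖x - y‖ := by
  have h := norm_exp_sub_exp_le x y
  have hmax : max ‖x‖ ‖y‖ ≤ 3 / 20 := max_le hx hy
  have hb := Real.exp_bound' (x := (3 : ℝ) / 20) (by norm_num) (by norm_num) (n := 1) Nat.one_pos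
  simp only [Finset.range_one, Finset.sum_singleton, pow_zero, Nat.factorial_zero, Nat.cast_one, div_one,
    pow_one, Nat.factorial_one, mul_one] at hb
  norm_num at hb
  have he : Real.exp (max ‖x‖ ‖y‖) ≤ 13 / 10 := (Real.exp_le_exp.2 hmax).trans (by linarith)
  calc ‖exp x - exp y‖ ≤ ‖x - y‖ * Real.exp (max ‖x‖ ‖y‖) := h
    _ ≤ ‖x - y‖ * (13 / 10) := mul_le_mul_of_nonneg_left he (norm_nonneg _)
    _ = 13 / 10 * ‖x - y‖ := by ring

/-- **THE THREE-EXPONENTIAL FACTOR IS `1 + O(‖A‖·‖B‖)`**: for `‖A‖ ≤ α`, `‖B‖ ≤ β`, `‖R‖ ≤ 2αβ`, `α + β ≤ 1/10`: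
`‖e^{B} · e^{−(A + B + R)} · e^{A} − 1‖ ≤ 7·α·β`.  (With `R` the mean BCH remainder this is the `W`-factor of the effective-gauge step;
the leading term is the commutator `[B, A]`; `= 0` if `A = 0` or `B = 0`.)  Two product-form BCH remainders, two exponential Lipschitz bounds.
[cite: Balaban1985Averaging, (31) p.22, (110) p.34] -/
theorem norm_exp_three_sub_one_le (A B R : 𝔸) {α β : ℝ} (hα : 0 ≤ α) (hβ : 0 ≤ β) (hA : ‖A‖ ≤ α) (hB : ‖B‖ ≤ β)
    (hR : ‖R‖ ≤ 2 * α * β) (hs : α + β ≤ 1 / 10) :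
    ‖exp B * exp (-(A + B + R)) * exp A - 1‖ ≤ 7 * α * β := by
  have hαβ0 : 0 ≤ α * β := mul_nonneg hα hβ
  have hαβ : α * β ≤ 1 / 400 := by
    have h1 : (α + β) ^ 2 ≤ (1 / 10) ^ 2 := by gcongr
    nlinarith [sq_nonneg (α - β), h1]
  -- the BCH remainder of `e^{−B} e^{−A}`
  have hsumBA : ‖-B‖ + ‖-A‖ ≤ 1 / 5 := by rw [norm_neg, norm_neg]; linarith
  set r₂ : 𝔸 := bchRem (-B) (-A) with hr₂
  have hr₂n : ‖r₂‖ ≤ 2 * α * β := by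
    calc ‖r₂‖ ≤ 2 * ‖-B‖ * ‖-A‖ := norm_bchRem_le hsumBA
      _ = 2 * ‖B‖ * ‖A‖ := by rw [norm_neg, norm_neg]
      _ ≤ 2 * β * α := by gcongr
      _ = 2 * α * β := by ring
  have hZ : exp (-B) * exp (-A) = exp (-(A + B) + r₂) := by
    have hlt : ‖exp (-B) * exp (-A) - 1‖ < 1 := norm_expMul_sub_one_lt_one (by linarith)
    have hlog : mlog (exp (-B) * exp (-A)) = -(A + B) + r₂ := by
      rw [hr₂, bchRem_def]; abel
    rw [← hlog, exp_mlog hlt]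
  -- sizes of the three exponents
  have hE₀ : ‖-(A + B)‖ ≤ 3 / 20 := by
    rw [norm_neg]; exact (norm_add_le _ _).trans (by linarith)
  have hE₁ : ‖-(A + B + R)‖ ≤ 3 / 20 := by
    rw [norm_neg]
    exact (norm_add_le _ _).trans ((add_le_add ((norm_add_le _ _).trans (add_le_add hA hB)) hR).trans (by linarith))
  have hE₂ : ‖-(A + B) + r₂‖ ≤ 3 / 20 :=
    (norm_add_le _ _).trans (by rw [norm_neg]; exact (add_le_add ((norm_add_le _ _).trans (add_le_add hA hB)) hr₂n).trans (by linarith))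
  -- the middle exponential is within `(13/10)(‖R‖ + ‖r₂‖)` of `e^{−B} e^{−A}`
  have hmid : ‖exp (-(A + B + R)) - exp (-B) * exp (-A)‖ ≤ 13 / 10 * (4 * α * β) := by
    rw [hZ]
    calc ‖exp (-(A + B + R)) - exp (-(A + B) + r₂)‖
        ≤ ‖exp (-(A + B + R)) - exp (-(A + B))‖ + ‖exp (-(A + B)) - exp (-(A + B) + r₂)‖ := norm_sub_le_norm_sub_add_norm_sub _ _ _
      _ ≤ 13 / 10 * ‖-(A + B + R) - -(A + B)‖ + 13 / 10 * ‖-(A + B) - (-(A + B) + r₂)‖ :=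
          add_le_add (norm_exp_sub_exp_le_small hE₁ hE₀) (norm_exp_sub_exp_le_small hE₀ hE₂)
      _ = 13 / 10 * ‖R‖ + 13 / 10 * ‖r₂‖ := by
          congr 2
          · rw [show -(A + B + R) - -(A + B) = -R by abel, norm_neg]
          · rw [show -(A + B) - (-(A + B) + r₂) = -r₂ by abel, norm_neg]
      _ ≤ 13 / 10 * (4 * α * β) := by nlinarith
  -- `e^{B} (e^{−B} e^{−A}) e^{A} = 1`
  have hone : exp B * (exp (-B) * exp (-A)) * exp A = 1 := by
    rw [← mul_assoc, Literature.Analysis.Calculus.exp_mul_exp_neg, one_mul, Literature.Analysis.Calculus.exp_neg_mul_exp]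
  have hkey : exp B * exp (-(A + B + R)) * exp A - 1 = exp B * (exp (-(A + B + R)) - exp (-B) * exp (-A)) * exp A := by
    rw [← hone]; noncomm_ring
  -- `e^x ≤ 1 + 2x` on `[0,1]` (Taylor with remainder, `Real.exp_bound'`)
  have hexp : ∀ x : ℝ, 0 ≤ x → x ≤ 1 → Real.exp x ≤ 1 + 2 * x := fun x hx0 hx1 => by
    have h := Real.exp_bound' hx0 hx1 (n := 1) Nat.one_pos
    simp only [Finset.range_one, Finset.sum_singleton, pow_zero, Nat.factorial_zero, Nat.cast_one, div_one,
      pow_one, Nat.factorial_one, mul_one] at h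
    norm_num at h
    linarith
  have heB : ‖exp B‖ ≤ 1 + 2 * β := (norm_exp_le_of_norm_le B hB).trans (hexp β hβ (by linarith))
  have heA : ‖exp A‖ ≤ 1 + 2 * α := (norm_exp_le_of_norm_le A hA).trans (hexp α hα (by linarith))
  rw [hkey]
  calc ‖exp B * (exp (-(A + B + R)) - exp (-B) * exp (-A)) * exp A‖
      ≤ ‖exp B‖ * ‖exp (-(A + B + R)) - exp (-B) * exp (-A)‖ * ‖exp A‖ :=
        (norm_mul_le _ _).trans (mul_le_mul_of_nonneg_right (norm_mul_le _ _) (norm_nonneg _))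
    _ ≤ (1 + 2 * β) * (13 / 10 * (4 * α * β)) * (1 + 2 * α) := by gcongr
    _ ≤ 7 * α * β := by nlinarith [mul_nonneg hαβ0 hα, mul_nonneg hαβ0 hβ, mul_nonneg (mul_nonneg hαβ0 hα) hβ]

/-! ## §2 The factor at the level of `exp[mean log]` -/

section Mean

variable {ι : Type*} [Fintype ι]

omit [NormOneClass 𝔸] in
/-- the value of the inverse unit of `eml W`: `(eml W)⁻¹ = exp(−mean_i log W_i)`. [folklore] -/
theorem coe_unit_eml_inv (W : ι → 𝔸) :
    (((isUnit_eml W).unit⁻¹ : 𝔸ˣ) : 𝔸) = exp (-meanCLM ι 𝔸 (fun i => mlog (W i))) := by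
  apply Units.inv_eq_of_mul_eq_one_right
  rw [IsUnit.unit_spec, eml_eq_exp_meanCLM, Literature.Analysis.Calculus.exp_mul_exp_neg]

/-- **THE `W`-FACTOR `G = eml(s)·eml(h·s)⁻¹·eml(h)` IS `1 + O(δ·m)`**: for `‖h_i − 1‖ ≤ δ`, `‖s_i − 1‖ ≤ m`, `δ + m ≤ 1/40`,
`‖eml(s) · exp(−mean_i log(h_i s_i)) · eml(h) − 1‖ ≤ 28·δ·m`. [cite: Balaban1985Averaging, (31) p.22, (110) p.34] -/
theorem norm_emlG_sub_one_le (h s : ι → 𝔸) {δ m : ℝ} (hδ : 0 ≤ δ) (hm : 0 ≤ m) (hh : ∀ i, ‖h i - 1‖ ≤ δ)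
    (hs : ∀ i, ‖s i - 1‖ ≤ m) (hsm : δ + m ≤ 1 / 40) :
    ‖eml s * exp (-meanCLM ι 𝔸 (fun i => mlog (h i * s i))) * eml h - 1‖ ≤ 28 * δ * m := by
  -- the logs
  have ha : ∀ i, ‖mlog (h i)‖ ≤ 2 * δ := fun i =>
    (norm_mlog_le_two_mul ((hh i).trans (by linarith))).trans (by linarith [hh i])
  have hb : ∀ i, ‖mlog (s i)‖ ≤ 2 * m := fun i =>
    (norm_mlog_le_two_mul ((hs i).trans (by linarith))).trans (by linarith [hs i])
  have hexpa : ∀ i, exp (mlog (h i)) = h i := fun i => exp_mlog (lt_of_le_of_lt (hh i) (by linarith))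
  have hexpb : ∀ i, exp (mlog (s i)) = s i := fun i => exp_mlog (lt_of_le_of_lt (hs i) (by linarith))
  -- `log(h_i s_i) = log h_i + log s_i + r_i`, `‖r_i‖ ≤ 8δm`
  have hlog : ∀ i, mlog (h i * s i) = mlog (h i) + mlog (s i) + bchRem (mlog (h i)) (mlog (s i)) := by
    intro i; rw [bchRem_def, hexpa, hexpb]; abel
  have hr : ∀ i, ‖bchRem (mlog (h i)) (mlog (s i))‖ ≤ 8 * δ * m := by
    intro i
    calc ‖bchRem (mlog (h i)) (mlog (s i))‖ ≤ 2 * ‖mlog (h i)‖ * ‖mlog (s i)‖ :=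
          norm_bchRem_le ((add_le_add (ha i) (hb i)).trans (by linarith))
      _ ≤ 2 * (2 * δ) * (2 * m) := by have h1 := ha i; have h2 := hb i; gcongr
      _ = 8 * δ * m := by ring
  -- means
  set A : 𝔸 := meanCLM ι 𝔸 (fun i => mlog (h i)) with hA
  set B : 𝔸 := meanCLM ι 𝔸 (fun i => mlog (s i)) with hB
  set R : 𝔸 := meanCLM ι 𝔸 (fun i => bchRem (mlog (h i)) (mlog (s i))) with hR
  have hmean : meanCLM ι 𝔸 (fun i => mlog (h i * s i)) = A + B + R := by
    have hf : (fun i => mlog (h i * s i)) = (fun i => mlog (h i)) + (fun i => mlog (s i)) + fun i => bchRem (mlog (h i)) (mlog (s i)) := by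
      funext i; simp only [Pi.add_apply, hlog i]
    rw [hf, map_add, map_add]
  have hAn : ‖A‖ ≤ 2 * δ := norm_meanCLM_le_of_forall_le _ (by positivity) ha
  have hBn : ‖B‖ ≤ 2 * m := norm_meanCLM_le_of_forall_le _ (by positivity) hb
  have hRn : ‖R‖ ≤ 2 * (2 * δ) * (2 * m) := by
    have := norm_meanCLM_le_of_forall_le _ (by positivity) hr; linarith
  rw [eml_eq_exp_meanCLM s, eml_eq_exp_meanCLM h, hmean]
  calc ‖exp B * exp (-(A + B + R)) * exp A - 1‖ ≤ 7 * (2 * δ) * (2 * m) :=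
        norm_exp_three_sub_one_le A B R (by positivity) (by positivity) hAn hBn hRn (by linarith)
    _ = 28 * δ * m := by ring

end Mean

/-! ## §3 The factor of the effective-gauge step -/

section Step

variable {P : Params} {j : ℕ}

/-- **`‖G − 1‖ ≤ 28·δ·m` FOR THE EFFECTIVE-GAUGE STEP**: with `hol_i` the centre stairs of `X` in the block of `y` (`‖hol_i − 1‖ ≤ δ`) and
`s_i = κ(x_i)⁻¹κ(ȳ)` the relative gauge factors (`‖s_i − 1‖ ≤ m`), the `W`-factor of ✓`effGauge_step_eq_eml_G`,
`G = [eml_i s_i] · [eml_i(hol_i·s_i)]⁻¹ · v(X)(y)`, satisfies `‖G − 1‖ ≤ 28·δ·m` whenever `δ + m ≤ 1/40`.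
[cite: Balaban1985Averaging, (31) p.22, (97)-(100) p.32, (110) p.34] -/
theorem norm_effGaugeG_sub_one_le (X : GaugeField P j 𝔸ˣ) (κ : GaugeTransf P j 𝔸ˣ)
    (y : Site P (j + 1)) {δ m : ℝ} (hδ : 0 ≤ δ) (hm : 0 ≤ m)
    (hhol : ∀ i : Idx P, ‖((holT X (emb y) (stairWord i.2.1 (off i.1)) : 𝔸ˣ) : 𝔸) - 1‖ ≤ δ)
    (hrel : ∀ i : Idx P, ‖((((κ (walkEnd (emb y) (stairWord i.2.1 (off i.1))))⁻¹ * κ (emb y) : 𝔸ˣ) : 𝔸)) - 1‖ ≤ m)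
    (hsm : δ + m ≤ 1 / 40) :
    ‖(((isUnit_eml (fun i : Idx P => (((κ (walkEnd (emb y) (stairWord i.2.1 (off i.1))))⁻¹ * κ (emb y) : 𝔸ˣ) : 𝔸))).unit *
          ((isUnit_eml (fun i : Idx P => ((holT X (emb y) (stairWord i.2.1 (off i.1)) : 𝔸ˣ) : 𝔸) *
            (((κ (walkEnd (emb y) (stairWord i.2.1 (off i.1))))⁻¹ * κ (emb y) : 𝔸ˣ) : 𝔸))).unit)⁻¹ *
          vframeU X y : 𝔸ˣ) : 𝔸) - 1‖ ≤ 28 * δ * m := by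
  rw [Units.val_mul, Units.val_mul, IsUnit.unit_spec, coe_unit_eml_inv, coe_vframeU]
  exact norm_emlG_sub_one_le _ _ hδ hm hhol hrel hsm

end Step

end Summit.QuantumFields.YangMills.Theorems.P1FlatCoreFrameLinGFactor

end
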